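import Summits.Ventures.YMGap.Census.DecimationInterpolated
import Summits.Ventures.YMGap.Census.VortexRatioInterpolation
import HarnessLib

/-!
# Venture YMGap, track (b) census — the interpolation parameter `α_Λ(t, r)` of Tomboulis's first decimation step EXISTS
# (arXiv:0707.2179, §3.2 eqs. (3.16)–(3.24); Prop. III.3 in weak form)

HONEST FRAMING: venture file of the cell `pub-ymgap` (QuantumFields programme), track (b) census.  Exact statements about one decimation
`(ℤ/bLℤ)^d → (ℤ/Lℤ)^d`, `L` even, `d ≥ 3`, on the positivity domain `f_c ≥ 0`; nothing about (5.15)/(5.16), confinement or any limit.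

Tomboulis defines `Z̃(α, t) = F₀^U^{h(α,t)|Λ^{(1)}|} Z_{Λ^{(1)}}({α c^U_j(r)})` ((3.16)/(3.19) with `c^L = 0`, `w(α) = α`; the tree's
`Tomboulis2007.tildeZ`) and fixes `α = α_Λ(t, r)` by `Z̃(α, t) = Z_Λ` ((3.23)–(3.24)), arguing ((3.22)) that `Z̃(α → 0) ≤ Z_Λ ≤ Z̃(1, t)`
by III.1–III.2 and that `Z̃` is increasing in `α` (III.3).  KERNEL (even coarse torus, `d ≥ 3`, `f_c ≥ 0`, `0 ≤ r ≤ 1`, `t > 0`):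
* `tildeZ_monotoneOn` — **III.3, weak form**: `α ↦ Z̃(α, t)` is non-decreasing on `(0, 1]` (II.1 (i) `coeffMonotone` + `h` increasing in
  `α` + `F₀^U ≥ 1`); the printed III.3 is STRICT monotonicity (uniqueness of `α_Λ`), not claimed;
* `tendsto_tildeZ_zero` — `Z̃(α, t) → 1` as `α ↓ 0` (`t > 0`);
* `exists_alpha_Ioc` — **existence of `α_Λ(t, r) ∈ (0, 1]`** with `Z̃(α, t) = Z_Λ` whenever `Z_Λ > 1` (i.e. not all `c_j` vanish), by the
  intermediate value theorem between `α ↓ 0` and `α = 1` (where `Z̃(1, t) ≥ Z_Λ` is III.1, `decimationUpperBound_of_nonneg_of_le_one`);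
* `exists_isAlpha_of_lt` — the tree's `IsAlpha d L b J r c t α` (`α ∈ (0,1)` OPEN) follows as soon as the III.1 inequality at `r` is STRICT
  on the instance (`Z_Λ < Z̃(1, t)`; printed "equality only in the trivial case", not a kernel theorem).
[cite: Tomboulis2007Confinement, §3.2 eqs. (3.16)–(3.24), Prop. III.3] [cite: ItoSeiler2007Tomboulis, §2 eqs. (2.4)–(2.6)]
-/

noncomputable section

open MeasureTheory Finset Real Filter Topology
open scoped BigOperators
open Literature.MathematicalPhysics.QuantumLattice
open Literature.MathematicalPhysics.QuantumFieldTheory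
open Literature.MathematicalPhysics.QuantumFieldTheory.Tomboulis2007

namespace Summit.Ventures.YMGap.Census

variable {d L b : ℕ} [NeZero b] [NeZero L]

/-! ### The bulk interpolation function `h(α, t)` -/

omit [NeZero b] [NeZero L] in
/-- `h(α, t) = exp(t - t/α)` for `α ≠ 0` (plumbing). -/
theorem interpH_eq (t : ℝ) {α : ℝ} (hα : α ≠ 0) : interpH α t = Real.exp (t - t / α) := by
  unfold interpH
  congr 1
  field_simp
  ring

omit [NeZero b] [NeZero L] in
/-- `h(1, t) = 1`. -/
theorem interpH_one (t : ℝ) : interpH 1 t = 1 := by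
  simp [interpH]

omit [NeZero b] [NeZero L] in
/-- `h(·, t)` is non-decreasing on `(0, ∞)` for `t ≥ 0`. -/
theorem interpH_mono {t : ℝ} (ht : 0 ≤ t) {α α' : ℝ} (hα : 0 < α) (hαα' : α ≤ α') : interpH α t ≤ interpH α' t := by
  rw [interpH_eq t hα.ne', interpH_eq t (hα.trans_le hαα').ne']
  refine Real.exp_le_exp.2 (sub_le_sub_left ?_ t)
  exact div_le_div_of_nonneg_left ht hα hαα'

omit [NeZero b] [NeZero L] in
/-- `h(·, t)` is continuous away from `α = 0`. -/
theorem continuousAt_interpH (t : ℝ) {α : ℝ} (hα : α ≠ 0) : ContinuousAt (fun a => interpH a t) α := by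
  unfold interpH
  exact (Real.continuous_exp.continuousAt).comp
    ((continuousAt_const.mul (continuousAt_const.sub continuousAt_id)).div continuousAt_id hα).neg

omit [NeZero b] [NeZero L] in
/-- `h(α, t) → 0` as `α ↓ 0` for `t > 0`. -/
theorem tendsto_interpH_zero {t : ℝ} (ht : 0 < t) : Tendsto (fun a => interpH a t) (𝓝[>] 0) (𝓝 0) := by
  have h1 : Tendsto (fun a : ℝ => t - t / a) (𝓝[>] 0) atBot := by
    have h := (tendsto_inv_nhdsGT_zero (𝕜 := ℝ)).const_mul_atTop ht
    have h' : Tendsto (fun a : ℝ => t - t * a⁻¹) (𝓝[>] 0) atBot := tendsto_atBot_add_const_left _ t (tendsto_neg_atTop_atBot.comp h)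
    refine h'.congr fun a => ?_
    rw [div_eq_mul_inv]
  have h2 := Real.tendsto_exp_atBot.comp h1
  refine h2.congr' ?_
  filter_upwards [self_mem_nhdsWithin] with a ha
  rw [Function.comp_apply, interpH_eq t (ne_of_gt ha)]

/-! ### `Z̃(α, t)`: monotone in `α` (III.3, weak form), its endpoints, and the existence of `α_Λ(t, r)` -/

omit [NeZero b] in
/-- `Z̃(1, t) = F₀^U(1)^{|Λ^{(1)}|} Z_{Λ^{(1)}}({c^U_j(1,r)})` — the right-hand side of III.1 (3.4). -/
theorem tildeZ_one (J : ℕ) (r : ℝ) (c : ℕ → ℝ) (t : ℝ) :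
    tildeZ d L b J r c 1 t = mkF0 J c (b ^ (d - 2)) b ^ Fintype.card (Plaquette d L) * torusZ d L (b ^ (d - 2) * J) (mkCoeff J c (b ^ (d - 2)) b r) := by
  unfold tildeZ
  rw [interpH_one, one_mul, Real.rpow_natCast, scaleCoeff_one]

omit [NeZero b] in
/-- **Prop. III.3, weak form (arXiv:0707.2179): `α ↦ Z̃(α, t)` is non-decreasing on `(0, 1]`** (even coarse torus, `d ≥ 3`, `t ≥ 0`,
`0 ≤ r`, positivity domain). -/
theorem tildeZ_monotoneOn (hd : 3 ≤ d) (hL : Even L) (J : ℕ) {c : ℕ → ℝ} (hc : ∀ n, 1 ≤ n → 0 ≤ c n) (hf : ∀ g : SU2, 0 ≤ plaqFn J c g)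
    {r : ℝ} (hr : 0 ≤ r) {t : ℝ} (ht : 0 ≤ t) : MonotoneOn (fun α => tildeZ d L b J r c α t) (Set.Ioc 0 1) := by
  haveI : NeZero d := ⟨by omega⟩
  haveI : Fact (1 < L) := ⟨by obtain ⟨k, hk⟩ := hL; have := NeZero.ne L; omega⟩
  intro α hα α' hα' hαα'
  have hadm := coeffAdmissible_mkCoeff_of_nonneg (b := b) J hc hf (b ^ (d - 2)) hr
  have hF : 1 ≤ mkF0 J c (b ^ (d - 2)) b := one_le_mkF0 hc _ b
  unfold tildeZ
  refine mul_le_mul ?_ ?_ ?_ ?_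
  · exact Real.rpow_le_rpow_of_exponent_le hF (mul_le_mul_of_nonneg_right (interpH_mono ht hα.1 hαα') (Nat.cast_nonneg _))
  · exact coeffMonotone hL _ _ _ (coeffAdmissible_scaleCoeff hadm ⟨hα.1.le, hα.2⟩) (coeffAdmissible_scaleCoeff hadm ⟨hα'.1.le, hα'.2⟩)
      fun n => by
        unfold scaleCoeff
        by_cases hn : 1 ≤ n
        · exact mul_le_mul_of_nonneg_right hαα' (hadm n hn).1
        · -- `n = 0`: both sides are `α · c^U_0`, and `c^U_0 = ĉ_0^{b²r} = 1`
          have h0 : n = 0 := by omega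
          subst h0
          have : mkCoeff J c (b ^ (d - 2)) b r 0 = 1 := by
            rw [mkCoeff_eq_rpow]
            unfold hatCoeff
            rw [div_self (mkFhat_zero_pos hc _).ne', Real.one_rpow]
          rw [this, mul_one, mul_one]
          exact hαα'
  · exact zero_le_one.trans (one_le_torusZ_even hd hL _ (coeffAdmissible_scaleCoeff hadm ⟨hα.1.le, hα.2⟩))
  · exact Real.rpow_nonneg (zero_le_one.trans hF) _

omit [NeZero b] in
/-- `α ↦ Z̃(α, t)` is continuous away from `α = 0`. -/
theorem continuousAt_tildeZ (J : ℕ) (r : ℝ) {c : ℕ → ℝ} (hc : ∀ n, 1 ≤ n → 0 ≤ c n) (t : ℝ) {α : ℝ} (hα : α ≠ 0) :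
    ContinuousAt (fun a => tildeZ d L b J r c a t) α := by
  unfold tildeZ
  have hF : mkF0 J c (b ^ (d - 2)) b ≠ 0 := (zero_lt_one.trans_le (one_le_mkF0 hc _ b)).ne'
  refine ContinuousAt.mul ?_ ((continuous_torusZ_scaleCoeff _ _).continuousAt)
  exact (Real.continuousAt_const_rpow hF).comp ((continuousAt_interpH t hα).mul continuousAt_const)

omit [NeZero b] in
/-- **`Z̃(α, t) → 1` as `α ↓ 0`** (`t > 0`): the bulk factor tends to `F₀^0 = 1` and `Z_{Λ^{(1)}}({α c^U}) → Z_{Λ^{(1)}}({0}) = 1`. -/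
theorem tendsto_tildeZ_zero (J : ℕ) (r : ℝ) {c : ℕ → ℝ} (hc : ∀ n, 1 ≤ n → 0 ≤ c n) {t : ℝ} (ht : 0 < t) :
    Tendsto (fun a => tildeZ d L b J r c a t) (𝓝[>] 0) (𝓝 1) := by
  unfold tildeZ
  have hF : mkF0 J c (b ^ (d - 2)) b ≠ 0 := (zero_lt_one.trans_le (one_le_mkF0 hc _ b)).ne'
  have h1 : Tendsto (fun a => mkF0 J c (b ^ (d - 2)) b ^ (interpH a t * (Fintype.card (Plaquette d L) : ℝ))) (𝓝[>] 0) (𝓝 1) := by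
    have he : Tendsto (fun a => interpH a t * (Fintype.card (Plaquette d L) : ℝ)) (𝓝[>] 0) (𝓝 0) := by
      simpa using (tendsto_interpH_zero ht).mul_const (Fintype.card (Plaquette d L) : ℝ)
    have h := ((Real.continuousAt_const_rpow hF).tendsto).comp he
    rwa [Real.rpow_zero] at h
  have h2 : Tendsto (fun a : ℝ => torusZ d L (b ^ (d - 2) * J) (scaleCoeff a (mkCoeff J c (b ^ (d - 2)) b r))) (𝓝[>] 0) (𝓝 1) := by
    have h := ((continuous_torusZ_scaleCoeff (d := d) (L := L) (b ^ (d - 2) * J) (mkCoeff J c (b ^ (d - 2)) b r)).tendsto 0).mono_left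
      (nhdsWithin_le_nhds (s := Set.Ioi (0 : ℝ)))
    rwa [torusZ_scaleCoeff_zero] at h
  simpa using h1.mul h2

/-- **Existence of `α_Λ(t, r)` (arXiv:0707.2179 (3.22)–(3.24), first step) up to the endpoint**: on an even coarse torus, `d ≥ 3`, for
admissible `c` with `f_c ≥ 0` and `Z_{(ℤ/bL)^d}({c_j}) > 1` (not all `c_j` vanish), every `0 ≤ r ≤ 1` and `t > 0`, there is
`α ∈ (0, 1]` with `Z̃(α, t) = Z_{(ℤ/bL)^d}({c_j})`. -/
theorem exists_alpha_Ioc (hd : 3 ≤ d) (hL : Even L) (J : ℕ) {c : ℕ → ℝ} (hc : CoeffAdmissible c) (hf : ∀ g : SU2, 0 ≤ plaqFn J c g)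
    (hZ : 1 < torusZ d (b * L) J c) {r : ℝ} (hr0 : 0 ≤ r) (hr1 : r ≤ 1) {t : ℝ} (ht : 0 < t) :
    ∃ α ∈ Set.Ioc (0 : ℝ) 1, tildeZ d L b J r c α t = torusZ d (b * L) J c := by
  haveI : NeZero d := ⟨by omega⟩
  have hc' : ∀ n, 1 ≤ n → 0 ≤ c n := fun n hn => (hc n hn).1
  -- near `α = 0` the interpolated partition function is below `Z_Λ`
  have hev : ∀ᶠ a in 𝓝[>] (0 : ℝ), tildeZ d L b J r c a t < torusZ d (b * L) J c ∧ a ∈ Set.Ioo (0 : ℝ) 1 := by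
    filter_upwards [(tendsto_tildeZ_zero (d := d) (L := L) (b := b) J r hc' ht).eventually (gt_mem_nhds hZ),
      Ioo_mem_nhdsGT_of_mem (show (0 : ℝ) ∈ Set.Ico (0 : ℝ) 1 from ⟨le_rfl, zero_lt_one⟩)] with a ha hb using ⟨ha, hb⟩
  obtain ⟨a₀, ha₀lt, ha₀⟩ := hev.exists
  -- at `α = 1` it is above `Z_Λ` (III.1)
  have h1 : torusZ d (b * L) J c ≤ tildeZ d L b J r c 1 t := by
    rw [tildeZ_one]
    exact decimationUpperBound_of_nonneg_of_le_one hL J hc hf hr0 hr1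
  -- intermediate value theorem on `[a₀, 1]`
  have hcont : ContinuousOn (fun a => tildeZ d L b J r c a t) (Set.Icc a₀ 1) := fun a ha =>
    (continuousAt_tildeZ J r hc' t (ha₀.1.trans_le ha.1).ne').continuousWithinAt
  obtain ⟨α, hα, hαeq⟩ := intermediate_value_Icc ha₀.2.le hcont ⟨ha₀lt.le, h1⟩
  exact ⟨α, ⟨ha₀.1.trans_le hα.1, hα.2⟩, hαeq⟩

/-- **`IsAlpha` from a STRICT III.1 instance**: if moreover `Z_{(ℤ/bL)^d}({c_j}) < Z̃(1, t)` (the III.1 inequality at `r` is strict on the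
instance — printed "equality only in the trivial case", not a kernel theorem), the tree's defining relation `IsAlpha d L b J r c t α` has a
solution `α ∈ (0, 1)`. -/
theorem exists_isAlpha_of_lt (hd : 3 ≤ d) (hL : Even L) (J : ℕ) {c : ℕ → ℝ} (hc : CoeffAdmissible c) (hf : ∀ g : SU2, 0 ≤ plaqFn J c g)
    (hZ : 1 < torusZ d (b * L) J c) {r : ℝ} (hr0 : 0 ≤ r) (hr1 : r ≤ 1) {t : ℝ} (ht : 0 < t)
    (hlt : torusZ d (b * L) J c < tildeZ d L b J r c 1 t) : ∃ α : ℝ, IsAlpha d L b J r c t α := by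
  obtain ⟨α, hα, hαeq⟩ := exists_alpha_Ioc hd hL J hc hf hZ hr0 hr1 ht
  have hα1 : α ≠ 1 := fun h => by rw [h] at hαeq; exact hlt.ne hαeq.symm
  exact ⟨α, ⟨hα.1, lt_of_le_of_ne hα.2 hα1⟩, hαeq⟩

end Summit.Ventures.YMGap.Census

end
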